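import Mathlib
import Summits.KontsevichZagierPeriods.Zeta5Search.CollinearityDigits
import Summits.KontsevichZagierPeriods.Zeta5Search.CellKitLevel
import HarnessLib

/-!
# ζ(5) search — orbit symmetrisation, the collinearity determinant, conjugation in `ZMod p`, and the shifted digit sums
# (tools for gen-2 g9's `CollinearityCriterion`, part 3 of 4)

Cell `pub-zeta5` (HONEST FRAMING: systematic search; no irrationality claim unless certified), typer seat generation 10.

* §1 (pure field algebra) `sum_mul_orbit_eq_two_mul`: for an involution `τ` of a finite set `D` with fixed points `C` and a weight `u`
  with `u(τx) = s·u(x)` off `C`, `Σ_D u·P_f = 2Σ_D u f` for the orbit vector `P_f(x) = 2f(x)` (on `C`) / `f(x) + s f(τx)`;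
  `collinear_det_eq_zero`: if all orbit vectors `(P_k, P_v)` lie on a line `aK + cV + e = 0`, `(a,c) ≠ 0`, and `e = 0` or the moments
  `Σ g`, `Σ wg` vanish, then `(Σ wgk)(Σ gv) − (Σ gk)(Σ wgv) = 0` (REPORT-gen2-g9 §6.2, the two-line proof).
* §2 conjugation on the deep classes read in `ZMod p`: closure (`conjClass_mem_deepClasses`), fixed points = centre classes
  (`centreIn_iff_conjClass_eq`), G2 `ḡ_x̄ = (−1)^{N+1}ḡ_x` (`cast_gHat_conjClass`, from `gHatConj_holds` + G1), `x̄ = b₀ − x` (`cast_conjClass`).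
* §3 `sum_unhit_shift_eq`: the digit sums of `b + e_j` over the unhit deep classes of `b` are the `π_j`-weighted deep sums of `b`,
  `π_j(x) = (b_j − x)(b₀ − b_j − x)` (G3 `gHatShift_holds` on unhit classes, and `π_j ≡ 0` on hit classes).

Nothing here bears on irrationality.
-/

noncomputable section

open Finset

namespace Summit.KontsevichZagierPeriods.Zeta5Search.ClusterValuation

open Summit.KontsevichZagierPeriods.Zeta5Search.DualSeries (InBox)
open Summit.KontsevichZagierPeriods.Zeta5Search.WedgeDictionary (coeffV dOf)
open Summit.KontsevichZagierPeriods.Zeta5Search.CasoratianValuation (InPolytope shift casoratian)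
open Summit.KontsevichZagierPeriods.Zeta5Search.BigPrime (shift_zero)
open Summit.KontsevichZagierPeriods.Zeta5Search.PadicSeries
open Summit.KontsevichZagierPeriods.Zeta5Search.LevelClass (padicNorm_vHat_le_one padicNorm_gHat_sub_le)

/-! ## §1  Field algebra: orbit symmetrisation and the collinearity determinant -/

section FieldLemmas

variable {F : Type*} [Field F] {α : Type*}

/-- **Orbit symmetrisation.**  For an involution `τ` of `D` with fixed-point set `C`, a weight `u` with `u(τx) = s·u(x)` off `C`:
`Σ_{x ∈ D} u(x)·P_f(x) = 2 Σ_{x ∈ D} u(x) f(x)`, where `P_f(x) = 2f(x)` on `C` and `f(x) + s f(τx)` off `C`. -/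
theorem sum_mul_orbit_eq_two_mul (D : Finset α) (τ : α → α) (C : α → Prop) [DecidablePred C]
    (u f : α → F) (s : F)
    (hτD : ∀ x ∈ D, τ x ∈ D) (hττ : ∀ x ∈ D, τ (τ x) = x) (hC : ∀ x ∈ D, C x ↔ τ x = x)
    (hu : ∀ x ∈ D, ¬ C x → u (τ x) = s * u x) :
    ∑ x ∈ D, u x * (if C x then 2 * f x else f x + s * f (τ x)) = 2 * ∑ x ∈ D, u x * f x := by
  have hL := (sum_filter_add_sum_filter_not D C
    (fun x => u x * (if C x then 2 * f x else f x + s * f (τ x)))).symm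
  have hR := (sum_filter_add_sum_filter_not D C (fun x => u x * f x)).symm
  rw [hL, hR, mul_add]
  congr 1
  · rw [mul_sum]
    exact sum_congr rfl fun x hx => by rw [if_pos (mem_filter.1 hx).2]; ring
  · have hsplit : ∑ x ∈ D.filter (fun x => ¬ C x), u x * (if C x then 2 * f x else f x + s * f (τ x)) =
        ∑ x ∈ D.filter (fun x => ¬ C x), u x * f x + ∑ x ∈ D.filter (fun x => ¬ C x), u (τ x) * f (τ x) := by
      rw [← sum_add_distrib]
      refine sum_congr rfl fun x hx => ?_
      obtain ⟨hxD, hxC⟩ := mem_filter.1 hx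
      rw [if_neg hxC, hu x hxD hxC]
      ring
    have hmap : ∀ x ∈ D.filter (fun x => ¬ C x), τ x ∈ D.filter (fun x => ¬ C x) := by
      intro x hx
      obtain ⟨hxD, hxC⟩ := mem_filter.1 hx
      refine mem_filter.2 ⟨hτD x hxD, fun hC' => hxC ?_⟩
      have h1 := (hC (τ x) (hτD x hxD)).1 hC'
      rw [hττ x hxD] at h1
      exact (hC x hxD).2 h1.symm
    have hreindex : ∑ x ∈ D.filter (fun x => ¬ C x), u (τ x) * f (τ x) =
        ∑ x ∈ D.filter (fun x => ¬ C x), u x * f x := by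
      refine sum_nbij' τ τ (fun x hx => mem_coe.2 (hmap x (mem_coe.1 hx))) (fun x hx => mem_coe.2 (hmap x (mem_coe.1 hx)))
        (fun x hx => hττ x (mem_filter.1 (mem_coe.1 hx)).1) (fun x hx => hττ x (mem_filter.1 (mem_coe.1 hx)).1)
        (fun x _ => rfl)
    rw [hsplit, hreindex, two_mul]

/-- **The collinearity determinant vanishes.**  Data: an involution `τ` of `D` with fixed points `C`, units `g` with `g(τx) = s·g(x)`
off `C`, a `τ`-invariant weight `w`, digits `k, v`.  If all orbit vectors `(P_k(x), P_v(x))` satisfy `a·P_k + c·P_v + e = 0` with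
`(a, c) ≠ 0`, and `e = 0` or the moments `Σ g`, `Σ w g` vanish, then
`(Σ w g k)(Σ g v) − (Σ g k)(Σ w g v) = 0` (characteristic `≠ 2`). -/
theorem collinear_det_eq_zero (D : Finset α) (τ : α → α) (C : α → Prop) [DecidablePred C]
    (g k v w : α → F) (s a c e : F) (h2 : (2 : F) ≠ 0)
    (hτD : ∀ x ∈ D, τ x ∈ D) (hττ : ∀ x ∈ D, τ (τ x) = x) (hC : ∀ x ∈ D, C x ↔ τ x = x)
    (hg : ∀ x ∈ D, ¬ C x → g (τ x) = s * g x) (hw : ∀ x ∈ D, w (τ x) = w x)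
    (hac : a ≠ 0 ∨ c ≠ 0)
    (hline : ∀ x ∈ D, a * (if C x then 2 * k x else k x + s * k (τ x)) +
      c * (if C x then 2 * v x else v x + s * v (τ x)) + e = 0)
    (hmom : e = 0 ∨ (∑ x ∈ D, g x = 0 ∧ ∑ x ∈ D, w x * g x = 0)) :
    (∑ x ∈ D, w x * g x * k x) * (∑ x ∈ D, g x * v x) -
      (∑ x ∈ D, g x * k x) * (∑ x ∈ D, w x * g x * v x) = 0 := by
  -- both weighted digit vectors lie on the line `aK + cV = 0`
  have key : ∀ u : α → F, (∀ x ∈ D, ¬ C x → u (τ x) = s * u x) → (e = 0 ∨ ∑ x ∈ D, u x = 0) →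
      a * ∑ x ∈ D, u x * k x + c * ∑ x ∈ D, u x * v x = 0 := by
    intro u hu hmu
    have hsum : ∑ x ∈ D, u x * (a * (if C x then 2 * k x else k x + s * k (τ x)) +
        c * (if C x then 2 * v x else v x + s * v (τ x)) + e) = 0 :=
      sum_eq_zero fun x hx => by rw [hline x hx, mul_zero]
    have hexp : ∑ x ∈ D, u x * (a * (if C x then 2 * k x else k x + s * k (τ x)) +
        c * (if C x then 2 * v x else v x + s * v (τ x)) + e) =
        a * ∑ x ∈ D, u x * (if C x then 2 * k x else k x + s * k (τ x)) +
        c * ∑ x ∈ D, u x * (if C x then 2 * v x else v x + s * v (τ x)) + e * ∑ x ∈ D, u x := by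
      rw [mul_sum, mul_sum, mul_sum, ← sum_add_distrib, ← sum_add_distrib]
      exact sum_congr rfl fun x _ => by ring
    rw [hexp, sum_mul_orbit_eq_two_mul D τ C u k s hτD hττ hC hu, sum_mul_orbit_eq_two_mul D τ C u v s hτD hττ hC hu] at hsum
    have he0 : e * ∑ x ∈ D, u x = 0 := by
      rcases hmu with h | h
      · rw [h, zero_mul]
      · rw [h, mul_zero]
    rw [he0, add_zero] at hsum
    have : (2 : F) * (a * ∑ x ∈ D, u x * k x + c * ∑ x ∈ D, u x * v x) = 0 := by linear_combination hsum
    exact (mul_eq_zero.1 this).resolve_left h2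
  have h1 := key g hg (hmom.imp id And.left)
  have h2' := key (fun x => w x * g x) (fun x hx hC' => by rw [hw x hx, hg x hx hC']; ring)
    (hmom.imp id And.right)
  rcases hac with ha | hc
  · have : a * ((∑ x ∈ D, w x * g x * k x) * (∑ x ∈ D, g x * v x) -
        (∑ x ∈ D, g x * k x) * (∑ x ∈ D, w x * g x * v x)) = 0 := by
      linear_combination (∑ x ∈ D, g x * v x) * h2' - (∑ x ∈ D, w x * g x * v x) * h1
    exact (mul_eq_zero.1 this).resolve_left ha
  · have : c * ((∑ x ∈ D, w x * g x * k x) * (∑ x ∈ D, g x * v x) -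
        (∑ x ∈ D, g x * k x) * (∑ x ∈ D, w x * g x * v x)) = 0 := by
      linear_combination (∑ x ∈ D, w x * g x * k x) * h1 - (∑ x ∈ D, g x * k x) * h2'
    exact (mul_eq_zero.1 this).resolve_left hc

end FieldLemmas

/-! ## §2  Conjugation on the deep classes, read in `ZMod p` -/

variable {p : ℕ} [hp : Fact p.Prime]

/-- `(−1)^{−N+1} = (−1)^{N+1}` (integer versus natural exponent). -/
theorem neg_one_zpow_neg_add_one (N : ℕ) : (-1 : ℚ) ^ (-(N : ℤ) + 1) = (-1 : ℚ) ^ (N + 1) := by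
  rcases Nat.even_or_odd N with ⟨k, hk⟩ | ⟨k, hk⟩
  · rw [Odd.neg_one_zpow ⟨-(k : ℤ), by rw [hk]; push_cast; ring⟩, Odd.neg_one_pow ⟨k, by rw [hk]; ring⟩]
  · rw [Even.neg_one_zpow ⟨-(k : ℤ), by rw [hk]; push_cast; ring⟩, Even.neg_one_pow ⟨k + 1, by rw [hk]; ring⟩]

section Conj

variable (b : ℕ → ℤ) (hb : InPolytope b) (hp5 : 5 ≤ p) (hpn : p ≤ (b 0).toNat) {N : ℕ} (hN : 1 ≤ N)
include hb hp5 hpn hN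

omit hp hp5 hN in
/-- The deep classes are closed under conjugation. -/
theorem conjClass_mem_deepClasses {x : ℕ} (hx : x ∈ deepClasses b p N) : conjClass b p x ∈ deepClasses b p N := by
  obtain ⟨hxr, hE⟩ := mem_filter.1 hx
  have hx' := mem_range.1 hxr
  have hp0 : 0 < p := by omega
  refine mem_filter.2 ⟨mem_range.2 (conjClass_lt b hp0 x), ?_⟩
  rwa [classExp_conj b hb.1.1 (by omega)]

omit hp hb hp5 hN in
/-- Self-conjugate ⟺ the class contains the centre (`x < p ≤ b₀`). -/
theorem centreIn_iff_conjClass_eq {x : ℕ} (hx : x < p) : CentreIn b p x ↔ conjClass b p x = x := by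
  have hnZ : (((b 0).toNat : ℕ) : ℤ) = b 0 := Int.toNat_of_nonneg (by omega)
  have hxn : x ≤ (b 0).toNat := by omega
  constructor
  · intro h
    unfold conjClass
    have hmod : ((b 0).toNat - x) % p = x % p := by
      refine (Nat.modEq_iff_dvd.2 ?_ : Nat.ModEq p x ((b 0).toNat - x)).symm
      rw [Nat.cast_sub hxn, hnZ]
      have e : (b 0 - (x : ℤ) - x) = -(2 * (x : ℤ) - b 0) := by ring
      rw [e]; exact h.neg_right
    rw [hmod, Nat.mod_eq_of_lt hx]
  · intro h
    unfold conjClass at h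
    have hmod : Nat.ModEq p x ((b 0).toNat - x) := by
      show x % p = ((b 0).toNat - x) % p
      rw [h, Nat.mod_eq_of_lt hx]
    have hd := Nat.modEq_iff_dvd.1 hmod
    rw [Nat.cast_sub hxn, hnZ] at hd
    unfold CentreIn
    have e : (2 * (x : ℤ) - b 0) = -(b 0 - (x : ℤ) - x) := by ring
    rw [e]; exact hd.neg_right

/-- **G2 in `ZMod p`**: `ḡ_{x̄} = (−1)^{N+1} ḡ_x` for a deep class `x` not containing the centre. -/
theorem cast_gHat_conjClass {x : ℕ} (hx : x ∈ deepClasses b p N) (hcx : ¬ CentreIn b p x) :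
    ((gHat b p (conjClass b p x) : ℚ) : ZMod p) = (-1 : ZMod p) ^ (N + 1) * ((gHat b p x : ℚ) : ZMod p) := by
  obtain ⟨hxr, hE⟩ := mem_filter.1 hx
  have hx' := mem_range.1 hxr
  have hprime := hp.out
  have hp0 : 0 < p := hprime.pos
  set n := (b 0).toNat with hn
  have hxn : x ≤ n := by omega
  have hxC : x ∈ classSet b p x := self_mem_classSet_of_classExp_neg b hx' (by omega)
  -- `n − x` and `x̄` both lie in the class of `x̄`
  have hc_lt : conjClass b p x < p := conjClass_lt b hp0 x
  have hcE : classExp b p (conjClass b p x) = -(N : ℤ) := by rw [classExp_conj b hb.1.1 hxn]; exact hE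
  have hcC : conjClass b p x ∈ classSet b p (conjClass b p x) := self_mem_classSet_of_classExp_neg b hc_lt (by omega)
  have hnxC : n - x ∈ classSet b p (conjClass b p x) := by
    rw [mem_classSet_conj_iff b hxn (Nat.sub_le n x), Nat.sub_sub_self hxn]; exact hxC
  -- G1: `ĝ_{x̄} ≡ ĝ_{n−x}`; G2: `ĝ_{n−x} = (−1)^{E+1} ĝ_x`
  have hG1 := padicNorm_gHat_sub_le b hb hp5 hc_lt hcC hnxC
  have hG2 := gHatConj_holds b p x x hb hprime hp5 hx' hcx hxC
  rw [hE, neg_one_zpow_neg_add_one] at hG2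
  rw [PInt.cast_eq_of_norm_sub_le (cast_gHat b hp5 _).1 (cast_gHat b hp5 _).1 hG1, hG2,
    PInt.cast_mul (PInt.pow (PInt.neg PInt.one) _) (cast_gHat b hp5 x).1]
  push_cast
  ring

omit hb hp5 hN in
/-- `x̄ = b₀ − x` in `ZMod p` (`x ≤ b₀`). -/
theorem cast_conjClass {x : ℕ} (hxn : x ≤ (b 0).toNat) :
    ((conjClass b p x : ℕ) : ZMod p) = ((b 0 : ℤ) : ZMod p) - x := by
  have hnZ : (((b 0).toNat : ℕ) : ℤ) = b 0 := Int.toNat_of_nonneg (by have := hp.out.two_le; omega)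
  unfold conjClass
  rw [ZMod.natCast_mod, Nat.cast_sub hxn]
  congr 1
  conv_rhs => rw [← hnZ]
  exact (Int.cast_natCast _).symm

end Conj

/-! ## §3  The shifted digit sums -/

section ShiftSums

variable (b : ℕ → ℤ) {j : ℕ} (hb : InPolytope b) (hb' : InPolytope (shift b j)) (hj1 : 1 ≤ j) (hj7 : j ≤ 7)
  (hp5 : 5 ≤ p) {N : ℕ} (hN : 1 ≤ N)
include hb hb' hj1 hj7 hp5 hN

/-- **The digit sums of `b + e_j` over the unhit deep classes of `b` are the `π_j`-weighted deep sums of `b`** (in `ZMod p`), for any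
class datum `f` that is shift-invariant on unhit classes (`f'` its value for `b + e_j`); `π_j(x) = (b_j − x)(b₀ − b_j − x)` kills the hit
deep classes. -/
theorem sum_unhit_shift_eq (f f' : ℕ → ZMod p)
    (hf : ∀ x ∈ deepClasses b p N, classExp (shift b j) p x = classExp b p x → f' x = f x) :
    ∑ x ∈ (deepClasses b p N).filter
        (fun x => (b j).toNat ∉ classSet b p x ∧ (b 0).toNat - (b j).toNat ∉ classSet b p x),
        ((gHat (shift b j) p x : ℚ) : ZMod p) * f' x =
      ∑ x ∈ deepClasses b p N, ((((b j : ℤ) : ZMod p) - x) * (((b 0 - b j : ℤ) : ZMod p) - x)) *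
        (((gHat b p x : ℚ) : ZMod p) * f x) := by
  have hprime := hp.out
  have hbox : InBox b := hb.1
  have h2 : 2 * b j ≤ b 0 := CellKit.two_mul_le_of_shift b hj1 hj7 hb'
  have hβ0 : 0 ≤ b j := by
    have := (hbox.2 (j - 1) (mem_range.2 (by omega))).1
    rwa [show j - 1 + 1 = j by omega] at this
  set β := (b j).toNat with hβ
  set n := (b 0).toNat with hn
  have hβn : (b 0 - b j).toNat = n - β := by omega
  have hβZ : (b j : ℤ) = β := by omega
  have hnβZ : (b 0 - b j : ℤ) = ((n - β : ℕ) : ℤ) := by omega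
  rw [← sum_filter_add_sum_filter_not (deepClasses b p N) (fun x => β ∉ classSet b p x ∧ n - β ∉ classSet b p x)
    (fun x => ((((b j : ℤ) : ZMod p) - x) * (((b 0 - b j : ℤ) : ZMod p) - x)) * (((gHat b p x : ℚ) : ZMod p) * f x))]
  -- the hit deep classes carry the weight `π_j(x) = 0`
  have hhit : ∑ x ∈ (deepClasses b p N).filter (fun x => ¬ (β ∉ classSet b p x ∧ n - β ∉ classSet b p x)),
      ((((b j : ℤ) : ZMod p) - x) * (((b 0 - b j : ℤ) : ZMod p) - x)) * (((gHat b p x : ℚ) : ZMod p) * f x) = 0 := by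
    refine sum_eq_zero fun x hx => ?_
    obtain ⟨-, hh⟩ := mem_filter.1 hx
    rcases not_and_or.1 hh with h | h <;> push Not at h
    · have hres : β % p = x % p := (mem_filter.1 h).2
      have : ((b j : ℤ) : ZMod p) = (x : ZMod p) := by
        rw [hβZ, Int.cast_natCast]; exact (ZMod.natCast_eq_natCast_iff' β x p).2 hres
      rw [this, sub_self, zero_mul, zero_mul]
    · have hres : (n - β) % p = x % p := (mem_filter.1 h).2
      have : ((b 0 - b j : ℤ) : ZMod p) = (x : ZMod p) := by
        rw [hnβZ, Int.cast_natCast]; exact (ZMod.natCast_eq_natCast_iff' (n - β) x p).2 hres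
      rw [this, sub_self, mul_zero, zero_mul]
  rw [hhit, add_zero]
  refine sum_congr rfl fun x hx => ?_
  obtain ⟨hxD, hu1, hu2⟩ := mem_filter.1 hx
  obtain ⟨hxr, hE⟩ := mem_filter.1 hxD
  have hx' := mem_range.1 hxr
  have hxC : x ∈ classSet b p x := self_mem_classSet_of_classExp_neg b hx' (by omega)
  have hEeq : classExp (shift b j) p x = classExp b p x := classExp_shift_of_unhit b hbox hj1 hj7 h2 hu1 hu2
  rw [hf x hxD hEeq, gHatShift_holds b p x x j hb hj1 hj7 hb' hprime hp5 hx' hxC hu1 (by rwa [hβn])]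
  have hπ : ((b j : ℚ) - x) * (((b 0 - b j : ℤ) : ℚ) - x) = (((b j - x) * (b 0 - b j - x) : ℤ) : ℚ) := by
    push_cast; ring
  rw [mul_assoc, hπ, PInt.cast_mul (cast_gHat b hp5 x).1 (PInt.intCast _), Rat.cast_intCast]
  push_cast
  ring

end ShiftSums

end Summit.KontsevichZagierPeriods.Zeta5Search.ClusterValuation

end
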